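/-
COR-CM (cell pub-hodgecm2, stage 2 of the Hodge ladder) — count-neutral KERNEL COMBINATORICS «order 16: the quaternion doublings `Q₈ × ℤ/2` and
`Q₈ ∘ ℤ/4` (Pauli)», part IV: PLANS and their finite validity test (seat prover-pub-hodgecm2-b23-g54-0, binder prover b23, gen 54; claim
HOME/INBOX.md l.25095).  Bookkeeping definitions with bodies (`Plan`, the Boolean tests `Plan.famOK … Plan.Valid`) + the lemmas unpacking a passed
test into propositions; pure finite combinatorics on part I, no group, no `decide`, no certificate, no named fact, no `sorry`.  `Interfaces.lean` (C1),
every E term, B01, `Transposition/*`, `PortJoin/*`, `D2Bridge/*` untouched.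
HONEST FRAMING: `HC_CM` is NOT proved, here or anywhere in the tree; nothing here is a period, a count of record or a headline.
T5: n/a-class (no hypothesis binders); checker: self.
-/
import Summits.HodgeConjecture.CorCM.Census.QuaternionDoublingModel

/-!
# The quaternion doublings, IV: plans

A **plan** for a twist `τ` is the finite data from which part VI runs seat b23 gen 46ʼs split index-two CHECKLIST
(`IndexTwoDescent.hodgeSpan_le_of_rep_checklist`) over the quaternion core:
* `fam` — the face family, as model faces `(Θ, p, q)` (the census family: one distance-lowering mixed face per block of distance `≥ 2` and the
  coordinate faces at one diagonal type);
* `reps` — one label per block, `tr` — for every one of the `256` labels (by code) the word moving it to its representative (an `H`-word for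
  diagonal labels);
* `desc` — for every representative of distance `≥ 2` two mismatched core places `(u, u')` whose mixed face `(ρ, u, u' + 4)` is in `fam`;
* `certs` — the CLOSING TABLE: signed face sums (two-cycle faces and coordinate faces at the diagonal representatives, square elements at the
  distance-`2` representatives, auxiliary targets) each with a certificate (part I) whose sources are family faces or earlier entries.
`Plan.Valid τ P` is the Boolean conjunction of the finite checks (§2); §3 unpacks a passed test into the propositions part VI consumes.  Part V
writes down the two plans and passes the test by `decide`.  All [folklore] bookkeeping over [Pohlmann1968, Thm 1].

## References
* [Pohlmann1968] H. Pohlmann, Algebraic cycles on abelian varieties of complex multiplication type, Ann. of Math. 88 (1968), Thm 1.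
-/

namespace Summit.HodgeConjecture.CorCM.Census.QuaternionDoubling

open Finset

noncomputable section

/-! ## §1 Plans -/

/-- **A plan**: face family, block representatives, transporter table, descending data, closing table. [folklore] -/
structure Plan where
  /-- the face family `(Θ, p, q)` -/
  fam : List (Lab × Fin 8 × Fin 8)
  /-- block representatives -/
  reps : List Lab
  /-- transporter table by code: `(word, index of the representative)` -/
  tr : List (Fin 16 × ℕ)
  /-- descending data: `(index of a far representative, u, u')` -/
  desc : List (ℕ × Fin 4 × Fin 4)
  /-- the closing table: targets with certificates, in proof order -/
  certs : List (Src × Cert)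

namespace Plan

variable (P : Plan) (τ : ZMod 2)

/-- The representative with index `r` (default `0`). [folklore] -/
def rep (r : ℕ) : Lab := P.reps.getD r 0

/-- The transporter entry of a label. [folklore] -/
def trOf (Θ : Lab) : Fin 16 × ℕ := P.tr.getD (code Θ) (0, 0)

/-- The family faces as one-term signed face sums. [folklore] -/
def famSrcs : List Src := P.fam.map fun f => [(f, 1)]

/-- All AVAILABLE signed face sums: family singletons and the targets of the closing table. [folklore] -/
def avail : List Src := P.famSrcs ++ P.certs.map Prod.fst

/-- The two-cycle face sum at `(ρ, u)`: `[(ρ, u, u+4)]`. [folklore] -/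
def twoCycleSrc (ρ : Lab) (u : Fin 4) : Src := [((ρ, hp u, xp u), 1)]

/-- The coordinate face sum at `(ρ, u, u')`: `[(ρ, u, u')]`. [folklore] -/
def coordSrc (ρ : Lab) (u u' : Fin 4) : Src := [((ρ, hp u, hp u'), 1)]

/-- The square element at `(ρ; u, u')`: `(ρ, u, u'+4) − (ρ, u', u+4)`. [folklore] -/
def squareSrc (ρ : Lab) (u u' : Fin 4) : Src := [((ρ, hp u, xp u'), 1), ((ρ, hp u', xp u), -1)]

/-- The mismatched core places of a label, as an increasing list. [folklore] -/
def devList (Θ : Lab) : List (Fin 4) := (List.finRange 4).filter fun u => u ∈ devSet τ Θ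

/-! ## §2 The finite tests -/

/-- (F) every family face has two distinct places. [folklore] -/
def famOK : Bool := P.fam.all fun f => decide (f.2.1 ≠ f.2.2)

/-- (T) the transporter table: every label is moved to its representative, diagonal labels by an `H`-word. [folklore] -/
def trOK : Bool := (List.finRange 256).all fun k =>
  decide ((P.tr.getD k.val (0, 0)).2 < P.reps.length) &&
  decide (Motw τ (P.tr.getD k.val (0, 0)).1 (labOfNat k.val) = P.rep (P.tr.getD k.val (0, 0)).2) &&
  (decide (Dst τ (labOfNat k.val) ≠ 0) || decide ((P.tr.getD k.val (0, 0)).1.val < 8))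

/-- (I) the representatives are pairwise inequivalent under the sixteen word motions. [folklore] -/
def inequivOK : Bool := (List.range P.reps.length).all fun a => (List.range P.reps.length).all fun b =>
  (List.finRange 16).all fun w => decide (Motw τ w (P.rep a) = P.rep b → a = b)

/-- (D) descending data at every representative of distance `≥ 2`. [folklore] -/
def descOK : Bool := (List.range P.reps.length).all fun r =>
  decide (Dst τ (P.rep r) < 2) || P.desc.any fun d => decide (d.1 = r) && decide (d.2.1 ≠ d.2.2) &&
    decide (d.2.1 ∈ devSet τ (P.rep r)) && decide (d.2.2 ∈ devSet τ (P.rep r)) && decide ((P.rep r, hp d.2.1, xp d.2.2) ∈ P.fam)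

/-- (C) the closing table in proof order: sources available so far, coded cancellation. [folklore] -/
def certsOKAux : List Src → List (Src × Cert) → Bool
  | _, [] => true
  | av, (tgt, C) :: rest => (C.1.all fun e => decide (e.1 ∈ av)) && cancels ((certList τ tgt C).map fun p => (code p.1, p.2)) &&
      certsOKAux (av ++ [tgt]) rest

/-- (C) from the family singletons. [folklore] -/
def certsOK : Bool := certsOKAux τ P.famSrcs P.certs

/-- (O) the checklist obligations are available: two-cycles and coordinate faces at diagonal representatives, squares at distance `2`. [folklore] -/
def obligOK : Bool := (List.range P.reps.length).all fun r =>
  (decide (Dst τ (P.rep r) ≠ 0) ||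
    ((List.finRange 4).all fun u => decide (twoCycleSrc (P.rep r) u ∈ P.avail)) &&
    ((List.finRange 4).all fun u => (List.finRange 4).all fun u' => decide (u < u' → coordSrc (P.rep r) u u' ∈ P.avail))) &&
  (decide (Dst τ (P.rep r) ≠ 2) ||
    decide (squareSrc (P.rep r) ((devList τ (P.rep r)).getD 0 0) ((devList τ (P.rep r)).getD 1 0) ∈ P.avail))

/-- **THE VALIDITY TEST.** [folklore] -/
def Valid : Bool := P.famOK && P.trOK τ && P.inequivOK τ && P.descOK τ && P.certsOK τ && P.obligOK τ

/-! ## §3 Unpacking a passed test -/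

variable {P τ}

/-- (F) unpacked. [folklore] -/
theorem fam_ne (h : P.Valid τ = true) {f : Lab × Fin 8 × Fin 8} (hf : f ∈ P.fam) : f.2.1 ≠ f.2.2 := by
  simp only [Valid, Bool.and_eq_true] at h
  have := h.1.1.1.1.1
  simp only [famOK, List.all_eq_true, decide_eq_true_eq] at this
  exact this f hf

/-- (T) unpacked: the transporter of a label moves it to a listed representative, by an `H`-word when the label is diagonal. [folklore] -/
theorem tr_spec (h : P.Valid τ = true) (Θ : Lab) :
    (P.trOf Θ).2 < P.reps.length ∧ Motw τ (P.trOf Θ).1 Θ = P.rep (P.trOf Θ).2 ∧ (Dst τ Θ = 0 → (P.trOf Θ).1.val < 8) := by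
  simp only [Valid, Bool.and_eq_true] at h
  have hT := h.1.1.1.1.2
  simp only [trOK, List.all_eq_true, Bool.and_eq_true, Bool.or_eq_true, decide_eq_true_eq] at hT
  obtain ⟨k, rfl⟩ := labOfNat_surjective Θ
  have hk := hT k (List.mem_finRange k)
  simp only [trOf, code_labOfNat]
  exact ⟨hk.1.1, hk.1.2, fun h0 => hk.2.resolve_left (fun hne => hne h0)⟩

/-- (I) unpacked. [folklore] -/
theorem inequiv (h : P.Valid τ = true) {a b : ℕ} (ha : a < P.reps.length) (hb : b < P.reps.length) (w : Fin 16)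
    (hw : Motw τ w (P.rep a) = P.rep b) : a = b := by
  simp only [Valid, Bool.and_eq_true] at h
  have hI := h.1.1.1.2
  simp only [inequivOK, List.all_eq_true, List.mem_range, decide_eq_true_eq] at hI
  exact hI a ha b hb w (List.mem_finRange w) hw

/-- (D) unpacked. [folklore] -/
theorem desc_spec (h : P.Valid τ = true) {r : ℕ} (hr : r < P.reps.length) (h2 : 2 ≤ Dst τ (P.rep r)) :
    ∃ u u' : Fin 4, u ≠ u' ∧ u ∈ devSet τ (P.rep r) ∧ u' ∈ devSet τ (P.rep r) ∧ (P.rep r, hp u, xp u') ∈ P.fam := by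
  simp only [Valid, Bool.and_eq_true] at h
  have hD := h.1.1.2
  simp only [descOK, List.all_eq_true, List.mem_range, Bool.or_eq_true, decide_eq_true_eq, List.any_eq_true] at hD
  rcases hD r hr with hlt | ⟨d, -, hd⟩
  · omega
  · simp only [Bool.and_eq_true, decide_eq_true_eq] at hd
    obtain ⟨⟨⟨⟨-, hne⟩, hu⟩, hu'⟩, hf⟩ := hd
    exact ⟨d.2.1, d.2.2, hne, hu, hu', hf⟩

/-- (C) unpacked, auxiliary form: along the table every certificate cancels and draws its sources from the faces available so far.
[folklore] -/
theorem certsOKAux_spec {M : Src → Prop} (hstep : ∀ (tgt : Src) (C : Cert), (∀ e ∈ C.1, M e.1) →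
      cancels ((certList τ tgt C).map fun p => (code p.1, p.2)) = true → M tgt) :
    ∀ (av : List Src) (cs : List (Src × Cert)), (∀ s ∈ av, M s) → certsOKAux τ av cs = true → ∀ t ∈ cs, M t.1 := by
  intro av cs
  induction cs generalizing av with
  | nil => intro _ _ t ht; simp at ht
  | cons tc rest ih =>
    intro hav hok t ht
    obtain ⟨tgt, C⟩ := tc
    simp only [certsOKAux, Bool.and_eq_true, List.all_eq_true, decide_eq_true_eq] at hok
    have htgt : M tgt := hstep tgt C (fun e he => hav e.1 (hok.1.1 e he)) hok.1.2
    rcases List.mem_cons.mp ht with rfl | ht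
    · exact htgt
    · refine ih (av ++ [tgt]) (fun s hs => ?_) hok.2 t ht
      rcases List.mem_append.mp hs with hs | hs
      · exact hav s hs
      · rw [List.mem_singleton] at hs; exact hs ▸ htgt

/-- (C) unpacked: if family faces satisfy `M` and `M` is closed under certified combination, every target of the table satisfies `M`. [folklore] -/
theorem certs_spec (h : P.Valid τ = true) {M : Src → Prop} (hfam : ∀ f ∈ P.fam, M [(f, 1)])
    (hstep : ∀ (tgt : Src) (C : Cert), (∀ e ∈ C.1, M e.1) → cancels ((certList τ tgt C).map fun p => (code p.1, p.2)) = true → M tgt) :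
    ∀ t ∈ P.certs, M t.1 := by
  simp only [Valid, Bool.and_eq_true] at h
  refine certsOKAux_spec hstep P.famSrcs P.certs (fun s hs => ?_) h.1.2
  obtain ⟨f, hf, rfl⟩ := List.mem_map.mp hs
  exact hfam f hf

/-- Everything available satisfies `M` (family singletons and targets). [folklore] -/
theorem avail_spec (h : P.Valid τ = true) {M : Src → Prop} (hfam : ∀ f ∈ P.fam, M [(f, 1)])
    (hstep : ∀ (tgt : Src) (C : Cert), (∀ e ∈ C.1, M e.1) → cancels ((certList τ tgt C).map fun p => (code p.1, p.2)) = true → M tgt)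
    {s : Src} (hs : s ∈ P.avail) : M s := by
  rcases List.mem_append.mp hs with hs | hs
  · obtain ⟨f, hf, rfl⟩ := List.mem_map.mp hs
    exact hfam f hf
  · obtain ⟨t, ht, rfl⟩ := List.mem_map.mp hs
    exact certs_spec h hfam hstep t ht

/-- (O) unpacked at a diagonal representative. [folklore] -/
theorem oblig_diag (h : P.Valid τ = true) {r : ℕ} (hr : r < P.reps.length) (h0 : Dst τ (P.rep r) = 0) :
    (∀ u : Fin 4, twoCycleSrc (P.rep r) u ∈ P.avail) ∧ (∀ u u' : Fin 4, u < u' → coordSrc (P.rep r) u u' ∈ P.avail) := by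
  simp only [Valid, Bool.and_eq_true] at h
  have hO := h.2
  simp only [obligOK, List.all_eq_true, List.mem_range, Bool.or_eq_true, Bool.and_eq_true, decide_eq_true_eq] at hO
  have hO := (hO r hr).1
  rcases hO with hne | ⟨h1, h2⟩
  · exact absurd h0 hne
  · exact ⟨fun u => h1 u (List.mem_finRange u), fun u u' huu' => h2 u (List.mem_finRange u) u' (List.mem_finRange u') huu'⟩

/-- (O) unpacked at a representative of distance `2`. [folklore] -/
theorem oblig_two (h : P.Valid τ = true) {r : ℕ} (hr : r < P.reps.length) (h2 : Dst τ (P.rep r) = 2) :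
    squareSrc (P.rep r) ((devList τ (P.rep r)).getD 0 0) ((devList τ (P.rep r)).getD 1 0) ∈ P.avail := by
  simp only [Valid, Bool.and_eq_true] at h
  have hO := h.2
  simp only [obligOK, List.all_eq_true, List.mem_range, Bool.or_eq_true, Bool.and_eq_true, decide_eq_true_eq] at hO
  rcases (hO r hr).2 with hne | hsq
  · exact absurd h2 hne
  · exact hsq

/-- The mismatched places listed by `devList` are exactly `devSet`, and the list has length `Dst`. [folklore] -/
theorem mem_devList_iff (Θ : Lab) (u : Fin 4) : u ∈ devList τ Θ ↔ u ∈ devSet τ Θ := by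
  simp [devList]

/-- `devList` has no duplicates. [folklore] -/
theorem devList_nodup (Θ : Lab) : (devList τ Θ).Nodup := (List.nodup_finRange 4).filter _

/-- `devList` has length `Dst`. [folklore] -/
theorem length_devList (Θ : Lab) : (devList τ Θ).length = Dst τ Θ := by
  rw [Dst, ← List.toFinset_card_of_nodup (devList_nodup Θ)]
  congr 1
  ext u
  rw [List.mem_toFinset, mem_devList_iff]

end Plan

end

end Summit.HodgeConjecture.CorCM.Census.QuaternionDoubling
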